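import Mathlib
import Summits.CriticalPhenomena.Ising3DConformalLimit.Theses.PerfectScreening

/-!
# Shell decomposition of the crux `SubharmonicOffOrigin` (stmt-CriticalPhenomena-1341)

Route `PerfectScreening`, crux r2 `SubharmonicOffOrigin` ("SubH"):
`∀ x ≠ 0, 6·G(x) ≤ ∑ᵢ (G(x+eᵢ) + G(x−eᵢ))`, `G = criticalTwoPoint 3`.

Crux-strategist decomposition (wall-breaker pass after two exhausted ideation rounds; all five
registered lines died at the same place, the FAR FIELD `‖x‖∞ ≥ 3`, with the near field
`‖x‖∞ ≤ 2` a finite certificate problem of a different kind — see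
`Cruxes/SubharmonicOffOrigin/STRATEGY-CENSUS.md`, `LEAD-SUMMARY-r1…r3.md`).  The crux is the
conjunction of three pieces of three different difficulty classes, indexed by the sup-norm shell
of `x`:

* `ShellOne`  — `‖x‖∞ = 1` (3 site classes `(1,0,0)`, `(1,1,0)`, `(1,1,1)`; margins `D = 1.4e-2,
  4.6e-3, ≈3e-3`; `(1,0,0)` is a theorem conditional on `InverseMFerromagnet ∧ PrecisionIsLaplacian`
  of route PrecisionLaplacian, `Dcs.subH_unitSteps_of_IM_of_PIL`): a certificate ≈ 4× beyond the
  printed LP lattice-bootstrap frontier;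
* `ShellTwo`  — `‖x‖∞ = 2` (6 classes, margins `≈ 1e-3 … 2e-3`): a certificate 10–50× beyond that
  frontier;
* `FarShell`  — `‖x‖∞ ≥ 3`: effective eventual subharmonicity = quantitative `η(3) > 0` with
  corrections-to-scaling control (open mathematics; the hard core).

This file proves the glue `ShellOne → ShellTwo → FarShell → SubharmonicOffOrigin` (trichotomy on
`‖x‖∞ ∈ {1}, {2}, [3,∞)` for `x ≠ 0`), with the three children stated VERBATIM as they are filed
on the route (`ledger route edit --split SubharmonicOffOrigin … --glue-by`), and the three converse
projections (each child follows from the crux), so that the split is an exact equivalence.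
-/

namespace Summit.CriticalPhenomena.Ising3DConformalLimit.Cruxes.SubharmonicOffOrigin.Strategist

open Summit.CriticalPhenomena.Ising3DConformalLimit.Theses.PerfectScreening (SubharmonicOffOrigin)

/-- **Glue of the shell split**: SubH at the sites of sup-norm `1`, at the sites of sup-norm `2`,
and at the sites of sup-norm `≥ 3` together give the crux `SubharmonicOffOrigin` (for `x ≠ 0` the
sup-norm is `1`, `2` or `≥ 3`). The three hypotheses are the children `ShellOne`, `ShellTwo`,
`FarShell` verbatim. [folklore] -/
theorem subharmonicOffOrigin_of_shells
    (hOne : ∀ x : Literature.Probability.LatticeModels.Site 3, x ≠ 0 → (∀ j : Fin 3, (x j).natAbs ≤ 1) → 6 * Literature.Probability.LatticeModels.criticalTwoPoint 3 x ≤ ∑ i : Fin 3, (Literature.Probability.LatticeModels.criticalTwoPoint 3 (x + Pi.single i 1) + Literature.Probability.LatticeModels.criticalTwoPoint 3 (x - Pi.single i 1)))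
    (hTwo : ∀ x : Literature.Probability.LatticeModels.Site 3, (∀ j : Fin 3, (x j).natAbs ≤ 2) → (∃ j : Fin 3, (x j).natAbs = 2) → 6 * Literature.Probability.LatticeModels.criticalTwoPoint 3 x ≤ ∑ i : Fin 3, (Literature.Probability.LatticeModels.criticalTwoPoint 3 (x + Pi.single i 1) + Literature.Probability.LatticeModels.criticalTwoPoint 3 (x - Pi.single i 1)))
    (hFar : ∀ x : Literature.Probability.LatticeModels.Site 3, (∃ j : Fin 3, 2 < (x j).natAbs) → 6 * Literature.Probability.LatticeModels.criticalTwoPoint 3 x ≤ ∑ i : Fin 3, (Literature.Probability.LatticeModels.criticalTwoPoint 3 (x + Pi.single i 1) + Literature.Probability.LatticeModels.criticalTwoPoint 3 (x - Pi.single i 1))) :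
    SubharmonicOffOrigin := by
  intro x hx
  by_cases hfar : ∃ j : Fin 3, 2 < (x j).natAbs
  · exact hFar x hfar
  · push Not at hfar
    by_cases htwo : ∃ j : Fin 3, (x j).natAbs = 2
    · exact hTwo x hfar htwo
    · push Not at htwo
      refine hOne x hx (fun j => ?_)
      have h1 := hfar j
      have h2 := htwo j
      omega

/-- Converse projection: the crux gives `ShellOne`. [folklore] -/
theorem shellOne_of_subharmonicOffOrigin (h : SubharmonicOffOrigin) :
    ∀ x : Literature.Probability.LatticeModels.Site 3, x ≠ 0 → (∀ j : Fin 3, (x j).natAbs ≤ 1) → 6 * Literature.Probability.LatticeModels.criticalTwoPoint 3 x ≤ ∑ i : Fin 3, (Literature.Probability.LatticeModels.criticalTwoPoint 3 (x + Pi.single i 1) + Literature.Probability.LatticeModels.criticalTwoPoint 3 (x - Pi.single i 1)) :=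
  fun x hx _ => h x hx

/-- Converse projection: the crux gives `ShellTwo` (a site with a coordinate of modulus `2` is
nonzero). [folklore] -/
theorem shellTwo_of_subharmonicOffOrigin (h : SubharmonicOffOrigin) :
    ∀ x : Literature.Probability.LatticeModels.Site 3, (∀ j : Fin 3, (x j).natAbs ≤ 2) → (∃ j : Fin 3, (x j).natAbs = 2) → 6 * Literature.Probability.LatticeModels.criticalTwoPoint 3 x ≤ ∑ i : Fin 3, (Literature.Probability.LatticeModels.criticalTwoPoint 3 (x + Pi.single i 1) + Literature.Probability.LatticeModels.criticalTwoPoint 3 (x - Pi.single i 1)) := by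
  intro x _ hx2
  refine h x ?_
  rintro rfl
  obtain ⟨j, hj⟩ := hx2
  simp at hj

/-- Converse projection: the crux gives `FarShell` (a site with a coordinate of modulus `> 2` is
nonzero). [folklore] -/
theorem farShell_of_subharmonicOffOrigin (h : SubharmonicOffOrigin) :
    ∀ x : Literature.Probability.LatticeModels.Site 3, (∃ j : Fin 3, 2 < (x j).natAbs) → 6 * Literature.Probability.LatticeModels.criticalTwoPoint 3 x ≤ ∑ i : Fin 3, (Literature.Probability.LatticeModels.criticalTwoPoint 3 (x + Pi.single i 1) + Literature.Probability.LatticeModels.criticalTwoPoint 3 (x - Pi.single i 1)) := by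
  intro x hx
  refine h x ?_
  rintro rfl
  obtain ⟨j, hj⟩ := hx
  simp at hj

/-- The split is exact: the crux is EQUIVALENT to the conjunction of its three shells. [folklore] -/
theorem subharmonicOffOrigin_iff_shells :
    SubharmonicOffOrigin ↔
      ((∀ x : Literature.Probability.LatticeModels.Site 3, x ≠ 0 → (∀ j : Fin 3, (x j).natAbs ≤ 1) → 6 * Literature.Probability.LatticeModels.criticalTwoPoint 3 x ≤ ∑ i : Fin 3, (Literature.Probability.LatticeModels.criticalTwoPoint 3 (x + Pi.single i 1) + Literature.Probability.LatticeModels.criticalTwoPoint 3 (x - Pi.single i 1))) ∧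
       (∀ x : Literature.Probability.LatticeModels.Site 3, (∀ j : Fin 3, (x j).natAbs ≤ 2) → (∃ j : Fin 3, (x j).natAbs = 2) → 6 * Literature.Probability.LatticeModels.criticalTwoPoint 3 x ≤ ∑ i : Fin 3, (Literature.Probability.LatticeModels.criticalTwoPoint 3 (x + Pi.single i 1) + Literature.Probability.LatticeModels.criticalTwoPoint 3 (x - Pi.single i 1))) ∧
       (∀ x : Literature.Probability.LatticeModels.Site 3, (∃ j : Fin 3, 2 < (x j).natAbs) → 6 * Literature.Probability.LatticeModels.criticalTwoPoint 3 x ≤ ∑ i : Fin 3, (Literature.Probability.LatticeModels.criticalTwoPoint 3 (x + Pi.single i 1) + Literature.Probability.LatticeModels.criticalTwoPoint 3 (x - Pi.single i 1)))) :=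
  ⟨fun h => ⟨shellOne_of_subharmonicOffOrigin h, shellTwo_of_subharmonicOffOrigin h,
    farShell_of_subharmonicOffOrigin h⟩,
   fun ⟨h1, h2, h3⟩ => subharmonicOffOrigin_of_shells h1 h2 h3⟩

end Summit.CriticalPhenomena.Ising3DConformalLimit.Cruxes.SubharmonicOffOrigin.Strategist
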